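import Summits.QuantumAdvantage.QuantumAdvantage.Theorems.AnchorDialEqui

/-!
# AnchorDial — part 11/11 «Law» (cell decomp-qadv, seat lens-2, generation 14 rev 5; supports item 26531 `ExactnessDial.PolyLossOddU3`)

§12d of the node: the arithmetic core in constant form `arith_core47` and THE LAW Prop-free with the constant explicit,
**`pointer_certificate_loss`**: for every `c` and all large `n`, every degree-`(log₂ n)^c` pointer certificate `(A, f)`
(anchor indicators unique on all but `2^{-12}` of the odd class, stable under all but an average `2^{-12}` of adjacent
pair-flips) leaves at least `2^{n-1}/47` odd inputs that are not certified wins.  Declarations verbatim from the node file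
`HOME/decomp-qadv-lens-2/g14/AnchorDial.lean` (rev 5); namespace `Summit.QuantumAdvantage.QuantumAdvantage.Theorems.AnchorDial`;
imports part 10.  Joint check `tree/Chain1234567891011.check.lean`.  Record: NODE-g14.md §REV 5.
-/

set_option linter.dupNamespace false
set_option linter.unusedVariables false

noncomputable section

open scoped Classical

namespace Summit.QuantumAdvantage.QuantumAdvantage.Theorems.AnchorDial

open Finset
open Literature.Computability.QuantumComplexity Literature.Computability.QuantumComplexity.RingHLF
open Literature.Computability.MetaComplexity Literature.Computability.MetaComplexity.Smolensky
open Summit.QuantumAdvantage.AdviceFreeQNC0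
open Summit.QuantumAdvantage.QuantumAdvantage.Theorems.HolonomyDial (gCond)

variable {N : ℕ}

section Law

/-- the arithmetic core in CONSTANT form: `P ≤ 47·L` (same hypotheses as `arith_core` without `47 ≤ n`). -/
theorem arith_core47 (n m O P NU U4 SITE H4 SU SH L η : ℕ)
    (hm : 3200 ≤ m) (h7 : n ≤ 7 * m)
    (hOP : P ≤ O) (hOP' : O ≤ P)
    (hU : 4096 * NU ≤ P) (hS : 4096 * SU ≤ n * P)
    (hpl : m * (512 * U4 + 32 * H4) ≤ 512 * SU + 32 * SH)
    (hSH : SH ≤ O) (hsite : SITE ≤ H4) (hη : 1600 * 10460353203 * η ≤ P)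
    (hsh : 32 * O ≤ 32 * NU + 512 * U4 + 32 * SITE + (20 * P + 320 * 10460353203 * η) + 512 * L) :
    P ≤ 47 * L := by
  have hA : 4096 * (m * (512 * U4 + 32 * H4)) ≤ 512 * (n * P) + 131072 * O := by
    have := Nat.mul_le_mul_left 4096 hpl
    omega
  have hB : n * P ≤ 7 * (m * P) := by
    have h := Nat.mul_le_mul_right P h7
    rw [Nat.mul_assoc] at h
    exact h
  have hC : 131072 * P ≤ 41 * (m * P) := by
    have h := Nat.mul_le_mul_right P (show 131072 ≤ 41 * m by omega)
    rw [Nat.mul_assoc] at h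
    exact h
  have hD : 4096 * (m * (512 * U4 + 32 * H4)) ≤ 3625 * (m * P) := by omega
  have hE : 4096 * (512 * U4 + 32 * H4) ≤ 3625 * P := by
    have h : m * (4096 * (512 * U4 + 32 * H4)) ≤ m * (3625 * P) := by
      rw [Nat.mul_left_comm m 4096, Nat.mul_left_comm m 3625]
      exact hD
    exact Nat.le_of_mul_le_mul_left h (by omega)
  omega

/-- **THE LAW in Prop-free constant form** (`movingPointerLoss3` with the constant made explicit): for every `c` and
all large `n`, every degree-`(log₂ n)^c` pointer certificate `(A, f)` on the `n`-cycle — anchor indicators `A_k`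
declaring exactly one anchor on all but `2^{-12}` of the odd class, stable under all but an average `2^{-12}` of the
adjacent pair-flips — has at least `2^{n-1}/47` odd inputs on which the certified bet («the kernel bit at the
pointer `k + [f_k ≠ 1]` is good») is NOT a win with a unique anchor. -/
theorem pointer_certificate_loss (c : ℕ) : ∃ n₀ : ℕ, ∀ n ≥ n₀, ∀ A f : Fin n → CubeFn (ZMod 3) n,
    (∀ k, A k ∈ lowDeg (ZMod 3) n ((Nat.log 2 n) ^ c)) → (∀ k, f k ∈ lowDeg (ZMod 3) n ((Nat.log 2 n) ^ c)) →
    4096 * (univ.filter fun x : Fin n → Bool =>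
        OddZeros x ∧ (univ.filter fun k : Fin n => A k x = 1).card ≠ 1).card ≤ 2 ^ (n - 1) →
    4096 * (∑ a ∈ range n, (univ.filter fun x : Fin n → Bool =>
        OddZeros x ∧ ∃ k : Fin n, ¬ ((A k (flip2 a (a + 1) x) = 1) ↔ (A k x = 1))).card) ≤ n * 2 ^ (n - 1) →
      2 ^ (n - 1) ≤ 47 * (univ.filter fun x : Fin n → Bool => OddZeros x ∧
          ¬ ∃ k : Fin n, (univ.filter fun k' : Fin n => A k' x = 1) = {k} ∧
            gCond x ((k.val + (if f k x = 1 then 0 else 1)) % n)).card := by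
  obtain ⟨n₀, hn₀⟩ := equi5Hyp c
  refine ⟨n₀, fun n hn A f hA hf hU hS => ?_⟩
  obtain ⟨m, η, hm, h5, h7, hη, hE⟩ := hn₀ n hn
  obtain ⟨t, ht, hpl⟩ := placement m n (by omega) (by omega)
    (fun a => (univ.filter fun x : Fin n → Bool => UB A a x).card) (Hc A)
  have hsh := shell_at A f hA hf (b₁ := m + t) (b₂ := 2 * m + t) (b₃ := 3 * m + t) (b₄ := 4 * m + t)
    (by omega) (by omega) (by omega) (by omega) η (hE t ht)
  rw [card_DatT, Fintype.card_fun, Fintype.card_bool, Fintype.card_fin] at hsh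
  have hU' : 4096 * (univ.filter fun x : Fin n → Bool => OddZeros x ∧ (anc A x).card ≠ 1).card ≤ 2 ^ (n - 1) := hU
  have hS' : 4096 * ∑ a ∈ range n, (univ.filter fun x : Fin n → Bool => UB A a x).card ≤ n * 2 ^ (n - 1) := by
    have e : ∀ a : ℕ, (univ.filter fun x : Fin n → Bool => UB A a x) = (univ.filter fun x : Fin n → Bool =>
        OddZeros x ∧ ∃ k : Fin n, ¬ ((A k (flip2 a (a + 1) x) = 1) ↔ (A k x = 1))) := fun a => by
      ext x; simp only [mem_filter, UB]
    simp_rw [e]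
    exact hS
  have hO := card_odd_ge (N := n) (by omega)
  have hO' := HolonomyDial.card_odd_le (n := n) (by omega)
  have hSH := sum_Hc_le A
  have hsite := card_site_le A (m + t) (2 * m + t) (3 * m + t) (4 * m + t)
  have h2n : 2 ^ n = 2 * 2 ^ (n - 1) := by
    rw [← pow_succ']
    congr 1
    omega
  rw [h2n] at hsh
  have key := arith_core47 n m _ (2 ^ (n - 1)) _ _ _ _ _ _
    ((univ.filter fun x : Fin n → Bool => OddZeros x ∧ ¬ CW A f x).card) η hm h7 hO hO' hU' hS' hpl hSH
    hsite hη (by omega)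
  have eL : (univ.filter fun x : Fin n → Bool => OddZeros x ∧ ¬ ∃ k : Fin n,
      (univ.filter fun k' : Fin n => A k' x = 1) = {k} ∧ gCond x ((k.val + (if f k x = 1 then 0 else 1)) % n)) =
      (univ.filter fun x : Fin n → Bool => OddZeros x ∧ ¬ CW A f x) := by
    ext x; simp only [mem_filter, CW, anc]
  rw [eL]
  exact key

end Law

end Summit.QuantumAdvantage.QuantumAdvantage.Theorems.AnchorDial

end
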